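import Literature.NumberTheory.GaloisRepresentations.ContinuousH2DiscreteGroup
import Literature.NumberTheory.GaloisRepresentations.GaloisSubgroups
import Literature.NumberTheory.GaloisRepresentations.AbsGaloisGroupCompact
import Mathlib.RepresentationTheory.Homological.GroupCohomology.Functoriality
import HarnessLib

/-!
# Inflation from a finite Galois layer into `H²(K, M)`: the finite-group `H²(Gal(L/K), M^{Γ_L})`
# (Mathlib `groupCohomology`, the class-module engine's currency) maps to the tree's `galoisCohomology`

Topic `NumberTheory/GaloisRepresentations`; namespace `Literature.NumberTheory.GaloisRepresentations`.
Definitions with bodies and theorems; no named fact, no instance, no notation.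

For a field `K : Type`, a finite normal subextension `L ⊆ K̄` (`Γ_L = Gal(K̄/L) =
absGaloisFixingSubgroup L ⊴ Γ_K`, OPEN) and a discrete `Γ_K`-module `ρ` on `M`, the tree has the
inflation `galoisCohomology.inf ρ Γ_L n : Hⁿ_cont(Γ_K ⧸ Γ_L, M^{Γ_L}) →+ Hⁿ(K, M)` out of the
CONTINUOUS cohomology of the (finite, discrete) quotient group `Γ_K ⧸ Γ_L`.  The class-module
engine (`Literature/Algebra/Homology`) and door-c4/door-c6's finite layers live in Mathlib's
`groupCohomology` of `Rep ℤ G`, `G = Gal(L/K)` a finite group.  This file closes the gap in degree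
two (Serre, *Galois Cohomology* I §2.2 Prop. 8: "`H^q(G, A) = lim→ H^q(G/U, A^U)`" — here the maps
of the directed system, for one open normal `U`):

* §1 the finite quotient: `absGaloisFixingSubgroup L = ker (resGal L)` (`rfl`),
  `discreteTopology_quotient_absGaloisFixingSubgroup` (`Γ_L` is open), and
  **`absGaloisQuotientEquiv L : Γ_K ⧸ Γ_L ≃* Gal(L/K)`** (`resGal` is onto,
  `QuotientGroup.quotientKerEquivOfSurjective`), with `absGaloisQuotientEquiv_mk`.
* §2 the layer module `absGaloisLayerRep ρ L : Rep ℤ (Γ_K ⧸ Γ_L)` on `M^{Γ_L}` (Mathlib `Rep.of` of the tree's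
  `quotientInvariants`), the comparison **`absGaloisLayerH2Equiv ρ L :
  groupCohomology (absGaloisLayerRep ρ L) 2 ≃ₗ[ℤ] continuousCohomology 2 (ρ.quotientInvariants Γ_L).toTopRep`**
  (`H2DiscreteEquiv` of `ContinuousH2DiscreteGroup`, the quotient being discrete), and
  **`infTwo ρ L : groupCohomology (absGaloisLayerRep ρ L) 2 →+ galoisCohomology ρ 2`**, with the cocycle formula
  **`infTwo_H2π`**: `inf [f] = [ (σ, τ) ↦ f(σ̄, τ̄) ]` (tree `map_twoCocycleClass`).
* §3 transport to the ABSTRACT Galois group: for a Mathlib representation `B : Rep ℤ Gal(L/K)` with a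
  `ℤ`-linear isomorphism `e' : B ≃ M^{Γ_L}` intertwining `absGaloisQuotientEquiv`,
  `infTwoOfIso : groupCohomology B 2 →+ galoisCohomology ρ 2` (Mathlib `groupCohomology.mapIso` then
  `infTwo`) — the shape in which a fundamental class `u_{L/K} ∈ H²(Gal(L/K), ·)` of the engine is sent
  to `H²(K, M)`.

Written for the bsd-schneider cell (crux `AnticycControlAdditiveK`, Route A towards Poitou–Tate: the
"G_K bridge" of memo FINDING-door-c6-g7 §7 (G6)).  Universe: `K M : Type` (the comparison
`H2DiscreteEquiv` has the group, ring and module in one universe, and `k = ℤ`).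

## References
* J.-P. Serre, *Galois Cohomology* (1997), Ch. I §2.2 Prop. 8, §2.6. [SerreGaloisCohomology1997]
* J. Neukirch, A. Schmidt, K. Wingberg, *Cohomology of Number Fields* (2008), (1.2.5), (1.5.1), (1.6.7).
  [NeukirchSchmidtWingberg2008]
-/

noncomputable section

open CategoryTheory groupCohomology Field

namespace Literature.NumberTheory.GaloisRepresentations

open LocalWeilDatum

-- Cup products / explicit `2`-cocycles need `LocallyCompactSpace Γ_K`; the tree's theorem
-- `absoluteGaloisGroup_compactSpace` (every field) is the only source of it.  Local to this file.
attribute [local instance] absoluteGaloisGroup_compactSpace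

variable (K : Type) [Field K]
variable (L : IntermediateField K (AlgebraicClosure K)) [FiniteDimensional K L] [Normal K L]

/-! ## §1. The finite quotient `Γ_K ⧸ Gal(K̄/L) ≅ Gal(L/K)` -/

omit [FiniteDimensional K L] in
/-- `Gal(K̄/L) = ker (Γ_K → Gal(L/K))` (definitionally: both are the kernel of `restrictNormalHom L`).
[cite: NeukirchANT1999, Ch. IV §1] -/
theorem absGaloisFixingSubgroup_eq_ker_resGal : absGaloisFixingSubgroup L = (resGal L).ker := rfl

/-- `Gal(K̄/L)` is open in `Γ_K` (`L/K` finite). [cite: NeukirchSchmidtWingberg2008, (1.2.5)] -/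
theorem isOpen_absGaloisFixingSubgroup :
    IsOpen (absGaloisFixingSubgroup L : Set (absoluteGaloisGroup K)) := by
  rw [← galFixing_eq_absGaloisFixingSubgroup]
  exact isOpen_galFixing K L

/-- **`Γ_K ⧸ Gal(K̄/L)` is discrete** (an open normal subgroup). [cite: NeukirchSchmidtWingberg2008, (1.2.5)] -/
theorem discreteTopology_quotient_absGaloisFixingSubgroup :
    DiscreteTopology (absoluteGaloisGroup K ⧸ absGaloisFixingSubgroup L) :=
  QuotientGroup.discreteTopology (isOpen_absGaloisFixingSubgroup K L)

omit [FiniteDimensional K L] in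
/-- **`Γ_K ⧸ Gal(K̄/L) ≃* Gal(L/K)`**, induced by the (surjective) restriction `resGal L : Γ_K → Gal(L/K)`.
[cite: NeukirchANT1999, Ch. IV §1][cite: SerreGaloisCohomology1997, I §2.2] -/
def absGaloisQuotientEquiv : absoluteGaloisGroup K ⧸ absGaloisFixingSubgroup L ≃* (L ≃ₐ[K] L) :=
  QuotientGroup.quotientKerEquivOfSurjective (resGal L) (resGal_surjective L)

omit [FiniteDimensional K L] in
/-- On classes: `absGaloisQuotientEquiv L [σ] = σ|_L`. [cite: NeukirchANT1999, Ch. IV §1] -/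
@[simp] theorem absGaloisQuotientEquiv_mk (σ : absoluteGaloisGroup K) :
    absGaloisQuotientEquiv K L (σ : absoluteGaloisGroup K ⧸ absGaloisFixingSubgroup L) = resGal L σ :=
  rfl

omit [FiniteDimensional K L] in
/-- … and on elements of `L`: `(absGaloisQuotientEquiv L [σ]) x = σ • x`. [cite: NeukirchANT1999, Ch. IV §1] -/
theorem coe_absGaloisQuotientEquiv_mk_apply (σ : absoluteGaloisGroup K) (x : L) :
    ((absGaloisQuotientEquiv K L (σ : absoluteGaloisGroup K ⧸ absGaloisFixingSubgroup L) x : L) :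
      AlgebraicClosure K) = σ • (x : AlgebraicClosure K) :=
  coe_resGal_apply L σ x

/-! ## §2. The layer module `M^{Γ_L}` as a `Rep` of the finite quotient; `H²` comparison and inflation -/

variable {M : Type} [AddCommGroup M] [TopologicalSpace M] [DiscreteTopology M] (ρ : DiscreteGaloisModule K M)

omit [FiniteDimensional K L] in
/-- **The layer module**: `M^{Γ_L}` with its action of `Γ_K ⧸ Γ_L`, as a Mathlib `Rep ℤ` (the underlying
representation of the tree's `quotientInvariants`). [cite: SerreGaloisCohomology1997, I §2.6] -/
abbrev absGaloisLayerRep : Rep ℤ (absoluteGaloisGroup K ⧸ absGaloisFixingSubgroup L) :=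
  Rep.of (ρ.quotientInvariants (absGaloisFixingSubgroup L)).toRepresentation

omit [FiniteDimensional K L] in
/-- Unfolding: the action of `[σ]` on `w ∈ M^{Γ_L}` is `ρ σ w`. [cite: SerreGaloisCohomology1997, I §2.6] -/
@[simp] theorem layerRep_ρ_mk_apply_coe (σ : absoluteGaloisGroup K)
    (w : Representation.invariants (ρ.toRepresentation.comp (absGaloisFixingSubgroup L).subtype)) :
    Subtype.val ((absGaloisLayerRep K L ρ).ρ (σ : absoluteGaloisGroup K ⧸ absGaloisFixingSubgroup L) w) =
      ρ σ w := rfl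

/-- **`H²(Γ_K ⧸ Γ_L, M^{Γ_L})` (Mathlib `groupCohomology`) `≃ H²_cont(Γ_K ⧸ Γ_L, M^{Γ_L})`** (the
quotient is finite discrete; `H2DiscreteEquiv`). [cite: SerreGaloisCohomology1997, I §2.3] -/
def absGaloisLayerH2Equiv :
    groupCohomology (absGaloisLayerRep K L ρ) 2 ≃ₗ[ℤ]
      (continuousCohomology 2 (ρ.quotientInvariants (absGaloisFixingSubgroup L)).toTopRep :
        TopModuleCat ℤ) :=
  haveI := discreteTopology_quotient_absGaloisFixingSubgroup K L
  H2DiscreteEquiv (ρ.quotientInvariants (absGaloisFixingSubgroup L)).toRepresentation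
    (ρ.quotientInvariants (absGaloisFixingSubgroup L)).toContRepresentation (fun _ _ => rfl)

/-- **Inflation `inf : H²(Γ_K ⧸ Γ_L, M^{Γ_L}) → H²(K, M)`** from Mathlib's finite-group `H²` of the layer
(the composite of `absGaloisLayerH2Equiv` with the tree's `galoisCohomology.inf`).
[cite: SerreGaloisCohomology1997, I §2.2 Prop. 8][cite: NeukirchSchmidtWingberg2008, (1.5.1)] -/
def infTwo : groupCohomology (absGaloisLayerRep K L ρ) 2 →+ galoisCohomology ρ 2 :=
  (galoisCohomology.inf ρ (absGaloisFixingSubgroup L) 2).comp (absGaloisLayerH2Equiv K L ρ).toAddMonoidHom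

/-- The inflated inhomogeneous `2`-cocycle `(σ, τ) ↦ f(σ̄, τ̄) ∈ M` of a `2`-cocycle `f` of the layer, as a
continuous `2`-cocycle of `Γ_K` (locally constant). [cite: SerreGaloisCohomology1997, I §2.2] -/
def inflateTwoCocycle (f : cocycles₂ (absGaloisLayerRep K L ρ)) : contTwoCocycles ρ.toTopRep :=
  haveI := discreteTopology_quotient_absGaloisFixingSubgroup K L
  contTwoCocycles.pullback (ContinuousMonoidHom.quotientMk (absGaloisFixingSubgroup L))
    (X := (ρ.quotientInvariants (absGaloisFixingSubgroup L)).toTopRep) (Y := ρ.toTopRep)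
    (TopRep.ofHom ⟨Submodule.subtypeL _, fun _ => rfl⟩)
    (cocycles₂ToContTwoCocycles (ρ.quotientInvariants (absGaloisFixingSubgroup L)).toRepresentation
      (ρ.quotientInvariants (absGaloisFixingSubgroup L)).toContRepresentation (fun _ _ => rfl) f)

/-- Unfolding: `inflateTwoCocycle f (σ, τ) = f(σ̄, τ̄)` in `M`. [cite: SerreGaloisCohomology1997, I §2.2] -/
@[simp] theorem inflateTwoCocycle_apply (f : cocycles₂ (absGaloisLayerRep K L ρ)) (σ τ : absoluteGaloisGroup K) :
    (inflateTwoCocycle K L ρ f).1 (σ, τ) =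
      Subtype.val ((f : (absoluteGaloisGroup K ⧸ absGaloisFixingSubgroup L) ×
          (absoluteGaloisGroup K ⧸ absGaloisFixingSubgroup L) → _)
        ((σ : absoluteGaloisGroup K ⧸ absGaloisFixingSubgroup L),
          (τ : absoluteGaloisGroup K ⧸ absGaloisFixingSubgroup L))) := rfl

/-- **The cocycle formula for inflation: `inf [f] = [(σ, τ) ↦ f(σ̄, τ̄)]`.**
[cite: SerreGaloisCohomology1997, I §2.2 Prop. 8][cite: NeukirchSchmidtWingberg2008, (1.5.1)] -/
theorem infTwo_H2π (f : cocycles₂ (absGaloisLayerRep K L ρ)) :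
    infTwo K L ρ (H2π (absGaloisLayerRep K L ρ) f) = twoCocycleClass ρ.toTopRep (inflateTwoCocycle K L ρ f) := by
  haveI := discreteTopology_quotient_absGaloisFixingSubgroup K L
  change galoisCohomology.inf ρ (absGaloisFixingSubgroup L) 2
    (H2DiscreteEquiv (ρ.quotientInvariants (absGaloisFixingSubgroup L)).toRepresentation
      (ρ.quotientInvariants (absGaloisFixingSubgroup L)).toContRepresentation (fun _ _ => rfl)
      (H2π (absGaloisLayerRep K L ρ) f)) = _
  rw [H2DiscreteEquiv_H2π]
  exact map_twoCocycleClass (ContinuousMonoidHom.quotientMk (absGaloisFixingSubgroup L))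
    (X := (ρ.quotientInvariants (absGaloisFixingSubgroup L)).toTopRep) (Y := ρ.toTopRep)
    (TopRep.ofHom ⟨Submodule.subtypeL _, fun _ => rfl⟩) _

/-! ## §3. Transport to a representation of the abstract group `Gal(L/K)` -/

variable {B : Rep ℤ (L ≃ₐ[K] L)}

/-- **Inflation from `H²(Gal(L/K), B)` to `H²(K, M)`** for a `Rep` `B` of the abstract group `Gal(L/K)`
IDENTIFIED with the layer: given an isomorphism `i : H²(Γ_K ⧸ Γ_L, M^{Γ_L}) ≅ H²(Gal(L/K), B)` (typically
Mathlib `groupCohomology.mapIso (absGaloisQuotientEquiv K L) e' he 2` for a `ℤ`-linear `e' : M^{Γ_L} ≃ B`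
with `e' ([σ] • w) = σ|_L • e' w`), the map `infTwo ∘ i⁻¹`.  This is the shape in which a fundamental
class `u_{L/K} ∈ H²(Gal(L/K), ·)` of the class-module engine is sent to `H²(K, M)`.
[cite: SerreGaloisCohomology1997, I §2.2 Prop. 8, §2.6 ("transport de structure")] -/
def infTwoOfIso (i : groupCohomology (absGaloisLayerRep K L ρ) 2 ≅ groupCohomology B 2) :
    groupCohomology B 2 →+ galoisCohomology ρ 2 :=
  (infTwo K L ρ).comp i.symm.toLinearEquiv.toAddMonoidHom

/-- `infTwoOfIso i (i x) = infTwo x`. [cite: SerreGaloisCohomology1997, I §2.6] -/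
theorem infTwoOfIso_apply_hom (i : groupCohomology (absGaloisLayerRep K L ρ) 2 ≅ groupCohomology B 2)
    (x : groupCohomology (absGaloisLayerRep K L ρ) 2) :
    infTwoOfIso K L ρ i (i.hom x) = infTwo K L ρ x := by
  change infTwo K L ρ (i.symm.toLinearEquiv (i.hom x)) = _
  congr 1
  exact i.toLinearEquiv.symm_apply_apply x

/-- … on cocycles: `infTwoOfIso i (i [f]) = [(σ, τ) ↦ f(σ̄, τ̄)]`.
[cite: SerreGaloisCohomology1997, I §2.2 Prop. 8] -/
theorem infTwoOfIso_apply_hom_H2π (i : groupCohomology (absGaloisLayerRep K L ρ) 2 ≅ groupCohomology B 2)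
    (f : cocycles₂ (absGaloisLayerRep K L ρ)) :
    infTwoOfIso K L ρ i (i.hom (H2π (absGaloisLayerRep K L ρ) f)) =
      twoCocycleClass ρ.toTopRep (inflateTwoCocycle K L ρ f) := by
  rw [infTwoOfIso_apply_hom, infTwo_H2π]

omit [FiniteDimensional K L] in
/-- The order of a class is preserved along `i` (e.g. a fundamental class of order `[L:K]`).
[cite: SerreGaloisCohomology1997, I §2.6] -/
theorem addOrderOf_absGaloisLayer_iso_hom (i : groupCohomology (absGaloisLayerRep K L ρ) 2 ≅ groupCohomology B 2)
    (x : groupCohomology (absGaloisLayerRep K L ρ) 2) :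
    addOrderOf (i.hom x) = addOrderOf x :=
  addOrderOf_injective i.toLinearEquiv.toAddMonoidHom i.toLinearEquiv.injective x

end Literature.NumberTheory.GaloisRepresentations

end
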